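import Literature.Topology.FourManifolds.IntersectionLatticeOrientationProofs
import Literature.AlgebraicTopology.SingularHomology.LocalDegreeSign
import Literature.Topology.FourManifolds.LinkTubularUniqueness
import Literature.Topology.FourManifolds.LinkingNumberProofs
import Mathlib.Analysis.InnerProductSpace.Projection.FiniteDimensional
import HarnessLib

/-!
# Oriented tubular neighbourhoods of knots transport one and the same local orientation

Topic `Literature/Topology/FourManifolds`; second file of the proof of the symmetry of the linking
number (`Knot.HasLinkingNumber.symm`, Rolfsen, *Knots and Links* (1976), §5.D Thm. 5.D.1), see
`LinkingNumberTorusClass.lean` for the plan. The cancellation `[∂N(K)] + [∂N(J)] = 0` of the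
boundary tori of a link exterior can only be read numerically once both tori are compared with one
model torus, through the two tubular neighbourhood maps `ν_K, ν_J : S¹ × ℝ² ↪ S³`; this comparison
is faithful exactly because both maps satisfy the **orientation convention `det_pos`** of
`Knot.TubularNbhd` (the frame `(ν, ∂_θ ν, ∂_{w₁} ν, ∂_{w₂} ν)` of `ℝ⁴` is positively oriented,
i.e. `ν` is orientation preserving for `S³ = ∂B⁴`). This file proves the homological content of
that convention:

* **`Knot.TubularNbhd.map_localClass_eq_of_map_localClass_eq`** — let `μ` be a homological
  `ℤ`-orientation of `S³` (Hatcher, *Algebraic Topology* (2002), §3.3), `ν₁`, `ν₂` oriented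
  tubular neighbourhoods of two (possibly different) knots, `m ∈ S¹ × ℝ²`, and
  `c ∈ H₃(S¹ × ℝ² | m; ℤ)` a local class of the model; if `(ν₁)_* c` is the local orientation
  `μ_{ν₁ m}` then `(ν₂)_* c` is the local orientation `μ_{ν₂ m}`. In words: all oriented tubes of
  all knots pull the orientation of `S³` back to the same orientation of `S¹ × ℝ²`.

The proof is the classical "an orientation-preserving diffeomorphism has local degree `+1`"
(Bredon, *Topology and Geometry* (1993), VI.7, proof of Thm. 7.15), organised so that no orientation of `S³` has to be computed:

1. **Hemisphere charts.** For a unit vector `u ∈ ℝ⁴` the open hemisphere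
   `H_u = {q ∈ S³ | ⟪u, q⟫ > 0}` is mapped homeomorphically onto the open unit ball of `ℝ³` by the
   *linear* map `c_u = (coordinates in an orthonormal basis `b` of `u^⊥`) ∘ (orthogonal projection)`
   (`Hemisphere`, `Hemisphere.homeo`).
2. **The Jacobian sign is constant on a hemisphere** (`det_minor_pos`,
   `PosGerm.det_coordL_comp_pos`): for a
   point `q ∈ H_u` and tangent vectors `f₁, f₂, f₃ ⊥ q` with `det[q, f₁, f₂, f₃] > 0` one has
   `ε · det(⟪b_j, f_i⟫)_{ij} > 0` with `ε = det[u, b₁, b₂, b₃] = ±1` — a column reduction of the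
   `4 × 4` determinant written in the orthonormal basis `(u, b)` using `⟪q, f_i⟫ = 0`, `‖q‖ = 1`.
   Hence for every `C¹` germ `F : (ℝ³, p) → S³ ⊆ ℝ⁴` satisfying the `det_pos` inequality with
   `F p ∈ H_u`, the map `c_u ∘ F` of open subsets of `ℝ³` has Jacobian of the fixed sign `ε` at
   `p`; composing `c_u` with a reflection of `ℝ³` if `ε = -1` we may take it positive.
3. **Linearisation** (the tree's `HomologicalOrientationOfSmooth.openSubsetIso_map_eq_map_affine`
   and `pres_of_affine`, `IntersectionLatticeOrientationProofs.lean`; the local-degree bookkeeping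
   `localHomology.isIso_map_of_isOpenEmbedding_of_eq` of `LocalDegreeSign.lean`; Bredon VI.7): a `C¹` local
   homeomorphism of `ℝ³` with positive Jacobian carries the reference generator `μ_E(p)` of
   `H₃(ℝ³ | p; ℤ)` to `μ_E` at the image point.
4. **One sign per hemisphere**: the orientation `μ` restricted to `H_u` and transported to the
   ball by `c_u`, and the reference orientation `μ_E` restricted to the ball, are two
   `ℤ`-orientations of a connected manifold, hence equal or opposite (Hatcher p. 234; tree
   `HomologicalOrientation.eq_or_eq_neg_of_connected_holds`). Consequently every `det_pos` germ
   `F` with `F p ∈ H_u` sends `μ_E(p)` to `σ_u · μ_{F p}` with one sign `σ_u` for the whole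
   hemisphere (`Hemisphere.exists_sign`, `PosGerm.push_eq`).
5. Two image points `ν₁ m`, `ν₂ m` lie in a common hemisphere unless antipodal, in which case a
   nearby point `ν₁ m'` is compared with both.

Everything here is proved; besides auxiliary definitions (`HomologicalOrientation.ofIsOpen`, the
hemisphere charts `Hemisphere`, positively oriented germs `PosGerm`, the parametrisation
`tubeParam : ℝ³ → S¹ × ℝ²`, `modelClass`) nothing is introduced — in particular no named fact —
and no statement of another file is modified.

## References

* D. Rolfsen, *Knots and Links*, Publish or Perish (1976), §5.D. [cite: Rolfsen1976, §5.D Thm 5.D.1]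
* G. E. Bredon, *Topology and Geometry*, GTM 139 (1993), VI.7, Thm. 7.15 and its proof (an
  orientation-preserving diffeomorphism acts as the identity on `Hₙ(ℝⁿ, ℝⁿ - 0)`).
  [cite: Bredon1993, VI.7 Thm. 7.15 (proof)]
* A. Hatcher, *Algebraic Topology*, CUP (2002), §3.3 pp. 231–236 (local orientations; two
  orientations of a connected manifold), Thm. 2.20 (excision). [cite: HatcherAT2002, §3.3]
-/

noncomputable section

open CategoryTheory Set Metric Filter Function
open scoped unitInterval Manifold ContDiff Topology RealInnerProductSpace
open Literature.AlgebraicTopology.SingularHomology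

universe u

namespace Literature.Topology.FourManifolds

/-- Local notation: `𝔼 n` is the model Euclidean space `EuclideanSpace ℝ (Fin n)`. -/
local notation "𝔼 " n:arg => EuclideanSpace ℝ (Fin n)

/-- Local notation: `𝕊 n` is the unit sphere in `EuclideanSpace ℝ (Fin (n + 1))`. -/
local notation "𝕊 " n:arg => (Metric.sphere (0 : EuclideanSpace ℝ (Fin (n + 1))) 1)

open HomologicalOrientationOfSmooth

attribute [local instance] fact_finrank_euclideanSpace_two fact_finrank_euclideanSpace_four

/-! ### Restriction of a homological orientation to an open subset -/

section OrientationRestriction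

variable {X Y : Type u} [TopologicalSpace X] [TopologicalSpace Y]

/-- **Restriction of a `ℤ`-orientation to an open subset** `O ⊆ X`: at `y ∈ O` the local
orientation `μ_y ∈ Hₙ(X | y)` read in `Hₙ(O | y)` through the excision isomorphism
(Hatcher 2002, §3.3 p. 231: local homology depends only on a neighbourhood; the local
consistency classes are restricted to closed neighbourhoods inside `O` and excised likewise).
[cite: HatcherAT2002, §3.3 p. 231] -/
def _root_.Literature.AlgebraicTopology.SingularHomology.HomologicalOrientation.ofIsOpen
    [T1Space X] [RegularSpace X] {n : ℕ} (μ : HomologicalOrientation ℤ X n) {O : Set X}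
    (hO : IsOpen O) : HomologicalOrientation ℤ (↥O) n where
  localClass y := (localHomology.openSubsetIso ℤ ℤ hO y.2 n).inv (μ.localClass (y : X))
  isGenerator y := by
    obtain ⟨e, he⟩ := μ.isGenerator (y : X)
    refine ⟨(localHomology.openSubsetIso ℤ ℤ hO y.2 n).toLinearEquiv.trans e, ?_⟩
    rw [LinearEquiv.trans_apply, Iso.toLinearEquiv_apply, Iso.inv_hom_id_apply, he]
  locallyConsistent y := by
    obtain ⟨K, hK, μK, hμK⟩ := μ.locallyConsistent (y : X)
    obtain ⟨K', hK'n, hK'c, hK'sub⟩ :=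
      exists_mem_nhds_isClosed_subset (inter_mem hK (hO.mem_nhds y.2))
    have hclK' : closure K' ⊆ O := by
      rw [hK'c.closure_eq]
      exact fun z hz ↦ (hK'sub hz).2
    have hK'K : K' ⊆ K := fun z hz ↦ (hK'sub hz).1
    refine ⟨Subtype.val ⁻¹' K', continuous_subtype_val.continuousAt.preimage_mem_nhds hK'n,
      (localHomologyOfSet.openSubsetIso ℤ ℤ hO hclK' n).inv (restrictLocal ℤ ℤ hK'K n μK),
      fun z hz ↦ ?_⟩
    rw [restrictToPoint_openSubsetIso_inv hO hclK' z hz n, restrictToPoint_restrictLocal_apply,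
      hμK _ (hK'K hz)]

/-- The defining property of the restricted orientation: excised back to `X`, its local class at
`y` is `μ_y`. [folklore] -/
theorem openSubsetIso_hom_ofIsOpen_localClass [T1Space X] [RegularSpace X] {n : ℕ}
    (μ : HomologicalOrientation ℤ X n) {O : Set X} (hO : IsOpen O) (y : ↥O) :
    (localHomology.openSubsetIso ℤ ℤ hO y.2 n).hom ((μ.ofIsOpen hO).localClass y) =
      μ.localClass (y : X) :=
  Iso.inv_hom_id_apply _ _

end OrientationRestriction

/-! ### Determinants in an orthonormal basis of `ℝ⁴` -/

section DetAlgebra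

variable (B : OrthonormalBasis (Fin 4) ℝ (𝔼 4)) (v : Fin 4 → 𝔼 4)

/-- The matrix of coordinates `M k i = ⟪B k, v i⟫` of four vectors `v i ∈ ℝ⁴` in the
orthonormal basis `B`. [folklore] -/
def coordMatrix : Matrix (Fin 4) (Fin 4) ℝ := Matrix.of fun k i ↦ ⟪B k, v i⟫

/-- The matrix with rows the standard coordinates of the vectors `w i`. [folklore] -/
def rowMatrix (w : Fin 4 → 𝔼 4) : Matrix (Fin 4) (Fin 4) ℝ := Matrix.of fun i j ↦ w i j

/-- The row matrix of four vectors is the matrix of the field `det_pos`. [folklore] -/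
theorem rowMatrix_eq_of (a b c d : 𝔼 4) : rowMatrix ![a, b, c, d] = Matrix.of ![⇑a, ⇑b, ⇑c, ⇑d] := by
  ext i j
  fin_cases i <;> rfl

/-- A real inner product in `ℝ⁴` is the sum of the products of the coordinates. [folklore] -/
theorem inner_eq_sum_mul_coord (x y : 𝔼 4) : ⟪x, y⟫ = ∑ j, x j * y j := by
  rw [EuclideanSpace.inner_eq_star_dotProduct, dotProduct]
  refine Finset.sum_congr rfl fun j _ ↦ ?_
  rw [star_trivial, mul_comm]

/-- The coordinate matrix is the product of the row matrix of the basis with the transpose of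
the row matrix of the vectors. [folklore] -/
theorem coordMatrix_eq_mul :
    coordMatrix B v = rowMatrix (⇑B) * Matrix.transpose (rowMatrix v) := by
  ext k i
  simp only [coordMatrix, rowMatrix, Matrix.of_apply, Matrix.mul_apply, Matrix.transpose_apply]
  exact inner_eq_sum_mul_coord (B k) (v i)

/-- `det ⟪B k, v i⟫ = det[B] · det[v]`. [folklore] -/
theorem det_coordMatrix : (coordMatrix B v).det = (rowMatrix (⇑B)).det * (rowMatrix v).det := by
  rw [coordMatrix_eq_mul, Matrix.det_mul, Matrix.det_transpose]

/-- **Column reduction of a frame determinant written in an orthonormal basis.** If `v 0` is a unit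
vector orthogonal to `v 1, v 2, v 3` and `a = ⟪B 0, v 0⟫ ≠ 0`, then the `3 × 3` minor of the
coordinates of `v 1, v 2, v 3` along `B 1, B 2, B 3` satisfies
`det (⟪B (l+1), v (i+1)⟫)_{l i} = a · det (⟪B k, v i⟫)_{k i}`: adding `⟪B (l+1), v 0⟫ / a` times the
row `l + 1` to the row `0` turns the row `0` into `(1/a, 0, 0, 0)` (Parseval: `Σ_k ⟪B k, v 0⟫² = 1`,
`Σ_k ⟪B k, v 0⟫ ⟪B k, v i⟫ = ⟪v 0, v i⟫ = 0`), and the determinant is expanded along that row.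
[folklore] -/
theorem det_minor_eq_inner_mul_det_coordMatrix (h0 : ‖v 0‖ = 1)
    (horth : ∀ i : Fin 3, ⟪v 0, v i.succ⟫ = 0) (ha : ⟪B 0, v 0⟫ ≠ 0) :
    (Matrix.of fun l i : Fin 3 ↦ ⟪B l.succ, v i.succ⟫).det = ⟪B 0, v 0⟫ * (coordMatrix B v).det := by
  set a : ℝ := ⟪B 0, v 0⟫ with ha_def
  set M := coordMatrix B v with hM
  -- coefficients of the row operation
  set c : Fin 3 → ℝ := fun l ↦ ⟪B l.succ, v 0⟫ / a with hc
  -- the reduced matrix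
  set M' : Matrix (Fin 4) (Fin 4) ℝ := Matrix.of fun k i ↦
    if k = 0 then M 0 i + ∑ l : Fin 3, c l * M l.succ i else M k i with hM'
  -- (1) `det M' = det M`: three elementary row operations
  have hdet : M'.det = M.det := by
    let M₁ : Matrix (Fin 4) (Fin 4) ℝ := Matrix.of fun k i ↦
      if k = 0 then M 0 i + c 0 * M 1 i else M k i
    let M₂ : Matrix (Fin 4) (Fin 4) ℝ := Matrix.of fun k i ↦
      if k = 0 then M 0 i + c 0 * M 1 i + c 1 * M 2 i else M k i
    have h₁ : M₁.det = M.det := by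
      refine Matrix.det_eq_of_forall_row_eq_smul_add_const (Pi.single 0 (c 0)) 1 (by simp) ?_
      intro k i
      by_cases hk : k = 0
      · subst hk; simp [M₁]
      · simp [M₁, hk]
    have h₂ : M₂.det = M₁.det := by
      refine Matrix.det_eq_of_forall_row_eq_smul_add_const (Pi.single 0 (c 1)) 2 (by simp) ?_
      intro k i
      by_cases hk : k = 0
      · subst hk
        simp [M₁, M₂]
      · have h2 : (2 : Fin 4) ≠ 0 := by decide
        simp [M₁, M₂, hk, h2]
    have h₃ : M'.det = M₂.det := by
      refine Matrix.det_eq_of_forall_row_eq_smul_add_const (Pi.single 0 (c 2)) 3 (by simp) ?_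
      intro k i
      by_cases hk : k = 0
      · subst hk
        simp [M₂, hM', Fin.sum_univ_three]
        ring
      · have h3 : (3 : Fin 4) ≠ 0 := by decide
        simp [M₂, hM', hk, h3]
    rw [h₃, h₂, h₁]
  -- (2) the new first row
  have hsq : a * a + ∑ l : Fin 3, ⟪B l.succ, v 0⟫ ^ 2 = 1 := by
    have h := B.sum_sq_inner_right (v 0)
    rw [Fin.sum_univ_succ, h0, one_pow] at h
    nlinarith [h]
  have hmix : ∀ i : Fin 3, a * ⟪B 0, v i.succ⟫ + ∑ l : Fin 3, ⟪B l.succ, v 0⟫ * ⟪B l.succ, v i.succ⟫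
      = 0 := fun i ↦ by
    have h := B.sum_inner_mul_inner (v 0) (v i.succ)
    rw [Fin.sum_univ_succ, horth i] at h
    simp_rw [real_inner_comm (B _) (v 0)] at h ⊢
    linarith [h]
  have hrow0 : M' 0 0 = 1 / a := by
    have : M' 0 0 = a + ∑ l : Fin 3, ⟪B l.succ, v 0⟫ / a * ⟪B l.succ, v 0⟫ := by
      simp [hM', hM, coordMatrix, hc, ha_def]
    have e1 : ∑ l : Fin 3, ⟪B l.succ, v 0⟫ / a * ⟪B l.succ, v 0⟫ =
        (∑ l : Fin 3, ⟪B l.succ, v 0⟫ ^ 2) / a := by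
      rw [Finset.sum_div]
      exact Finset.sum_congr rfl fun l _ ↦ by ring
    rw [this, e1, show ∑ l : Fin 3, ⟪B l.succ, v 0⟫ ^ 2 = 1 - a * a by linarith [hsq]]
    field_simp
    ring
  have hrow : ∀ i : Fin 3, M' 0 i.succ = 0 := fun i ↦ by
    have : M' 0 i.succ = ⟪B 0, v i.succ⟫ + ∑ l : Fin 3, ⟪B l.succ, v 0⟫ / a * ⟪B l.succ, v i.succ⟫ := by
      simp [hM', hM, coordMatrix, hc, ha_def]
    have e1 : ∑ l : Fin 3, ⟪B l.succ, v 0⟫ / a * ⟪B l.succ, v i.succ⟫ =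
        (∑ l : Fin 3, ⟪B l.succ, v 0⟫ * ⟪B l.succ, v i.succ⟫) / a := by
      rw [Finset.sum_div]
      exact Finset.sum_congr rfl fun l _ ↦ by ring
    rw [this, e1, show ∑ l : Fin 3, ⟪B l.succ, v 0⟫ * ⟪B l.succ, v i.succ⟫ = -(a * ⟪B 0, v i.succ⟫)
      by linarith [hmix i]]
    field_simp
    ring
  -- (3) expansion along the first row
  have hexp := Matrix.det_succ_row_zero M'
  rw [Fin.sum_univ_succ] at hexp
  have hvan : ∑ i : Fin 3, (-1 : ℝ) ^ ((i.succ : Fin 4) : ℕ) * M' 0 i.succ *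
      (M'.submatrix Fin.succ (Fin.succAbove i.succ)).det = 0 :=
    Finset.sum_eq_zero fun i _ ↦ by rw [hrow i, mul_zero, zero_mul]
  rw [hvan, add_zero] at hexp
  have hsub : M'.submatrix Fin.succ (Fin.succAbove 0) = Matrix.of fun l i : Fin 3 ↦ ⟪B l.succ, v i.succ⟫ := by
    ext l i
    simp [hM', hM, coordMatrix, Matrix.submatrix, Fin.succ_ne_zero]
  rw [hsub, hrow0] at hexp
  simp only [Fin.val_zero, pow_zero, one_mul] at hexp
  rw [← hdet, hexp]
  field_simp

/-- **Positivity of the chart Jacobian on a hemisphere.** If `det[B] > 0`, `‖v 0‖ = 1`,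
`⟪B 0, v 0⟫ > 0`, the vectors `v 1, v 2, v 3` are orthogonal to `v 0` and `det[v] > 0` (standard
coordinates), then the `3 × 3` minor `det (⟪B (l+1), v (i+1)⟫)` is positive. [folklore] -/
theorem det_minor_pos (hB : 0 < (rowMatrix (⇑B)).det) (h0 : ‖v 0‖ = 1) (ha : 0 < ⟪B 0, v 0⟫)
    (horth : ∀ i : Fin 3, ⟪v 0, v i.succ⟫ = 0) (hv : 0 < (rowMatrix v).det) :
    0 < (Matrix.of fun l i : Fin 3 ↦ ⟪B l.succ, v i.succ⟫).det := by
  rw [det_minor_eq_inner_mul_det_coordMatrix B v h0 horth ha.ne', det_coordMatrix]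
  positivity

end DetAlgebra

/-! ### Hemisphere charts of the `3`-sphere -/

/-- **Hemisphere chart data**: a unit vector `u ∈ ℝ⁴` together with an orthonormal basis
`(u, b 0, b 1, b 2)` of `ℝ⁴` which is *positively oriented* (`det > 0` in standard coordinates).
The associated chart of the open hemisphere `{q ∈ S³ | ⟪u, q⟫ > 0}` is `q ↦ (⟪b j, q⟫)_j`.
[folklore] -/
structure Hemisphere where
  /-- The pole of the hemisphere. -/
  u : 𝔼 4
  /-- Three further vectors. -/
  b : Fin 3 → 𝔼 4
  /-- `(u, b)` is an orthonormal family. -/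
  orthonormal : Orthonormal ℝ (Matrix.vecCons u b : Fin 4 → 𝔼 4)
  /-- `(u, b)` is positively oriented. -/
  det_pos : 0 < (rowMatrix (Matrix.vecCons u b)).det

namespace Hemisphere

variable (H : Hemisphere)

/-- The orthonormal basis `(u, b 0, b 1, b 2)` of `ℝ⁴`. [folklore] -/
def basis : OrthonormalBasis (Fin 4) ℝ (𝔼 4) :=
  OrthonormalBasis.mk H.orthonormal (by
    rw [top_le_iff]
    refine H.orthonormal.linearIndependent.span_eq_top_of_card_eq_finrank ?_
    simp)

/-- The basis is `(u, b 0, b 1, b 2)`. [folklore] -/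
@[simp] theorem basis_apply (k : Fin 4) : H.basis k = Matrix.vecCons H.u H.b k := by
  rw [basis, OrthonormalBasis.coe_mk]

/-- The first basis vector is the pole `u`. [folklore] -/
theorem basis_zero : H.basis 0 = H.u := by simp

/-- The further basis vectors are the `b l`. [folklore] -/
theorem basis_succ (l : Fin 3) : H.basis l.succ = H.b l := by simp

/-- The pole is a unit vector. [folklore] -/
theorem norm_u : ‖H.u‖ = 1 := by simpa using H.orthonormal.norm_eq_one 0

/-- The pole is orthogonal to the `b l`. [folklore] -/
theorem inner_u_b (l : Fin 3) : ⟪H.u, H.b l⟫ = 0 := by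
  have h := H.basis.inner_eq_zero (Fin.succ_ne_zero l).symm
  simpa using h

/-- The `b l` are orthonormal. [folklore] -/
theorem inner_b_b (l l' : Fin 3) : ⟪H.b l, H.b l'⟫ = if l = l' then 1 else 0 := by
  have h := H.basis.inner_eq_ite l.succ l'.succ
  simpa [Fin.succ_inj] using h

/-- The open hemisphere `{q ∈ S³ | ⟪u, q⟫ > 0}`. [folklore] -/
def dom : Set (𝕊 3) := {q | 0 < ⟪H.u, (q : 𝔼 4)⟫}

/-- The open hemisphere is open. [folklore] -/
theorem isOpen_dom : IsOpen H.dom :=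
  isOpen_lt continuous_const (continuous_const.inner continuous_subtype_val)

/-- Membership in the open hemisphere. [folklore] -/
theorem mem_dom {q : 𝕊 3} : q ∈ H.dom ↔ 0 < ⟪H.u, (q : 𝔼 4)⟫ := Iff.rfl

/-- The linear coordinate map `x ↦ (⟪b j, x⟫)_j : ℝ⁴ → ℝ³`. [folklore] -/
def coordL : 𝔼 4 →L[ℝ] 𝔼 3 :=
  (EuclideanSpace.equiv (Fin 3) ℝ).symm.toContinuousLinearMap.comp
    (ContinuousLinearMap.pi fun j ↦ innerSL ℝ (H.b j))

/-- The coordinates of the chart are the inner products with the `b j`. [folklore] -/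
@[simp] theorem coordL_apply (x : 𝔼 4) (j : Fin 3) : H.coordL x j = ⟪H.b j, x⟫ := by
  simp [coordL]

/-- Parseval in the basis `(u, b)`: `⟪u, x⟫² + Σ ⟪b j, x⟫² = ‖x‖²`. [folklore] -/
theorem inner_u_sq_add_norm_coordL_sq (x : 𝔼 4) :
    ⟪H.u, x⟫ ^ 2 + ‖H.coordL x‖ ^ 2 = ‖x‖ ^ 2 := by
  have h := H.basis.sum_sq_inner_right x
  rw [Fin.sum_univ_succ] at h
  simp only [basis_apply, Matrix.cons_val_zero, Matrix.cons_val_succ] at h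
  rw [← h, EuclideanSpace.norm_sq_eq]
  congr 1
  refine Finset.sum_congr rfl fun j _ ↦ ?_
  rw [coordL_apply, Real.norm_eq_abs, sq_abs]

/-- Expansion in the basis `(u, b)`: `x = ⟪u, x⟫ u + Σ ⟪b j, x⟫ b j`. [folklore] -/
theorem inner_u_smul_add_sum (x : 𝔼 4) :
    ⟪H.u, x⟫ • H.u + ∑ j : Fin 3, ⟪H.b j, x⟫ • H.b j = x := by
  have h := H.basis.sum_repr' x
  rw [Fin.sum_univ_succ] at h
  simpa using h

/-- The inverse chart `y ↦ Σ y_j b j + √(1 - ‖y‖²) u : ℝ³ → ℝ⁴`. [folklore] -/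
def lift (y : 𝔼 3) : 𝔼 4 := ∑ j : Fin 3, y j • H.b j + Real.sqrt (1 - ‖y‖ ^ 2) • H.u

/-- The inverse chart is continuous. [folklore] -/
theorem continuous_lift : Continuous H.lift := by
  unfold lift
  fun_prop

/-- Coordinates of a combination of the `b l`. [folklore] -/
theorem inner_b_sum (y : 𝔼 3) (j : Fin 3) : ⟪H.b j, ∑ l : Fin 3, y l • H.b l⟫ = y j := by
  rw [inner_sum]
  simp_rw [real_inner_smul_right, inner_b_b]
  simp

/-- A combination of the `b l` is orthogonal to the pole. [folklore] -/
theorem inner_u_sum (y : 𝔼 3) : ⟪H.u, ∑ l : Fin 3, y l • H.b l⟫ = 0 := by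
  rw [inner_sum]
  simp_rw [real_inner_smul_right, inner_u_b]
  simp

/-- The height of the inverse chart over the equatorial hyperplane. [folklore] -/
theorem inner_u_lift (y : 𝔼 3) : ⟪H.u, H.lift y⟫ = Real.sqrt (1 - ‖y‖ ^ 2) := by
  rw [lift, inner_add_right, inner_u_sum, real_inner_smul_right, real_inner_self_eq_norm_sq,
    H.norm_u]
  simp

/-- The chart is a left inverse of the inverse chart. [folklore] -/
theorem coordL_lift (y : 𝔼 3) : H.coordL (H.lift y) = y := by
  ext j
  rw [coordL_apply, lift, inner_add_right, inner_b_sum, real_inner_smul_right,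
    real_inner_comm, inner_u_b, mul_zero, add_zero]

/-- A combination of the orthonormal `b l` has the norm of its coefficient vector. [folklore] -/
theorem norm_sum_smul_b (y : 𝔼 3) : ‖∑ l : Fin 3, y l • H.b l‖ ^ 2 = ‖y‖ ^ 2 := by
  have h := H.inner_u_sq_add_norm_coordL_sq (∑ l : Fin 3, y l • H.b l)
  rw [inner_u_sum] at h
  have hc : H.coordL (∑ l : Fin 3, y l • H.b l) = y := by
    ext j
    rw [coordL_apply, inner_b_sum]
  rw [hc] at h
  nlinarith [h]

/-- The inverse chart lands in the unit sphere. [folklore] -/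
theorem norm_lift {y : 𝔼 3} (hy : ‖y‖ < 1) : ‖H.lift y‖ = 1 := by
  have h := H.inner_u_sq_add_norm_coordL_sq (H.lift y)
  rw [inner_u_lift, coordL_lift, Real.sq_sqrt (by nlinarith [norm_nonneg y])] at h
  have h1 : ‖H.lift y‖ ^ 2 = 1 := by linarith
  have h2 : 0 ≤ ‖H.lift y‖ := norm_nonneg _
  nlinarith [h1, h2]

/-- The chart lands in the open unit ball. [folklore] -/
theorem norm_coordL_lt {q : 𝕊 3} (hq : q ∈ H.dom) : ‖H.coordL (q : 𝔼 4)‖ < 1 := by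
  have h := H.inner_u_sq_add_norm_coordL_sq (q : 𝔼 4)
  rw [norm_eq_of_mem_sphere q, one_pow] at h
  have ha : 0 < ⟪H.u, (q : 𝔼 4)⟫ := hq
  have h1 : ‖H.coordL (q : 𝔼 4)‖ ^ 2 < 1 := by nlinarith [h, ha]
  have h2 : 0 ≤ ‖H.coordL (q : 𝔼 4)‖ := norm_nonneg _
  nlinarith [h1, h2]

/-- The inverse chart is a left inverse of the chart on the hemisphere. [folklore] -/
theorem lift_coordL {q : 𝕊 3} (hq : q ∈ H.dom) : H.lift (H.coordL (q : 𝔼 4)) = q := by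
  have ha : 0 < ⟪H.u, (q : 𝔼 4)⟫ := hq
  have h := H.inner_u_sq_add_norm_coordL_sq (q : 𝔼 4)
  rw [norm_eq_of_mem_sphere q, one_pow] at h
  have hsqrt : Real.sqrt (1 - ‖H.coordL (q : 𝔼 4)‖ ^ 2) = ⟪H.u, (q : 𝔼 4)⟫ := by
    rw [show 1 - ‖H.coordL (q : 𝔼 4)‖ ^ 2 = ⟪H.u, (q : 𝔼 4)⟫ ^ 2 by linarith,
      Real.sqrt_sq ha.le]
  rw [lift, hsqrt]
  simp_rw [coordL_apply]
  rw [add_comm]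
  exact H.inner_u_smul_add_sum (q : 𝔼 4)

/-- **The hemisphere chart** `{q ∈ S³ | ⟪u, q⟫ > 0} ≃ₜ (open unit ball of ℝ³)`, `q ↦ (⟪b j, q⟫)_j`,
with inverse `y ↦ Σ y_j b j + √(1 - ‖y‖²) u` (a graph chart of the sphere). [folklore] -/
def homeo : ↥H.dom ≃ₜ ↥(ball (0 : 𝔼 3) 1) where
  toFun q := ⟨H.coordL (q : 𝕊 3), by rw [mem_ball_zero_iff]; exact H.norm_coordL_lt q.2⟩
  invFun y := ⟨⟨H.lift y, by
      rw [mem_sphere_zero_iff_norm]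
      exact H.norm_lift (mem_ball_zero_iff.1 y.2)⟩, by
      show 0 < ⟪H.u, H.lift y⟫
      rw [inner_u_lift]
      exact Real.sqrt_pos.2 (by nlinarith [mem_ball_zero_iff.1 y.2, norm_nonneg (y : 𝔼 3)])⟩
  left_inv q := Subtype.ext (Subtype.ext (H.lift_coordL q.2))
  right_inv y := Subtype.ext (H.coordL_lift y)
  continuous_toFun := by
    refine Continuous.subtype_mk ?_ _
    exact H.coordL.continuous.comp (continuous_subtype_val.comp continuous_subtype_val)
  continuous_invFun := by
    refine Continuous.subtype_mk (Continuous.subtype_mk ?_ _) _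
    exact H.continuous_lift.comp continuous_subtype_val

/-- The hemisphere chart as a function. [folklore] -/
@[simp] theorem homeo_apply_coe (q : ↥H.dom) : (H.homeo q : 𝔼 3) = H.coordL (q : 𝕊 3) := rfl

/-- The chart as a map to `ℝ³`. [folklore] -/
def chart : C(↥H.dom, 𝔼 3) := ⟨fun q ↦ H.coordL (q : 𝕊 3), by fun_prop⟩

/-- The chart as a function. [folklore] -/
@[simp] theorem chart_apply (q : ↥H.dom) : H.chart q = H.coordL (q : 𝕊 3) := rfl

/-- The chart is the inclusion of the ball composed with the homeomorphism. [folklore] -/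
theorem chart_eq_comp : H.chart = (subsetIncl (ball (0 : 𝔼 3) 1)).comp (H.homeo : C(↥H.dom, ↥(ball (0 : 𝔼 3) 1))) :=
  rfl

/-- The chart is an open embedding `{⟪u, ·⟫ > 0} ↪ ℝ³`. [folklore] -/
theorem isOpenEmbedding_chart : Topology.IsOpenEmbedding H.chart := by
  rw [chart_eq_comp, ContinuousMap.coe_comp]
  exact isOpen_ball.isOpenEmbedding_subtypeVal.comp H.homeo.isOpenEmbedding

/-- The chart is injective. [folklore] -/
theorem chart_injective : Function.Injective H.chart := H.isOpenEmbedding_chart.injective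

/-! #### Existence of positively oriented hemisphere data at a pole -/

/-- Every unit vector of `ℝ⁴` is the pole of a positively oriented hemisphere chart: complete it
to an orthonormal basis and, if necessary, change the sign of one basis vector. [folklore] -/
theorem exists_of_norm_eq_one (u : 𝔼 4) (hu : ‖u‖ = 1) : ∃ H : Hemisphere, H.u = u := by
  -- an orthonormal basis of `ℝ⁴` through `u`
  haveI : Fact (Module.finrank ℝ (𝔼 4) = 3 + 1) := ⟨by simp⟩
  have hu0 : u ≠ 0 := by
    rintro rfl
    simp at hu
  set b₀ : OrthonormalBasis (Fin 3) ℝ (ℝ ∙ u)ᗮ := OrthonormalBasis.fromOrthogonalSpanSingleton 3 hu0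
  set b : Fin 3 → 𝔼 4 := fun j ↦ (b₀ j : 𝔼 4) with hb
  have hub : ∀ j, ⟪u, b j⟫ = 0 := fun j ↦
    Submodule.inner_right_of_mem_orthogonal (Submodule.mem_span_singleton_self u) (b₀ j).2
  have hbb : ∀ j j', ⟪b j, b j'⟫ = if j = j' then 1 else 0 := fun j j' ↦ by
    rw [hb]
    simp only
    rw [← Submodule.coe_inner, b₀.inner_eq_ite]
  -- orthonormality of `(u, ± b 0, b 1, b 2)`
  have hon : ∀ s : ℝ, s * s = 1 → Orthonormal ℝ (Matrix.vecCons u (Function.update b 0 (s • b 0)) :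
      Fin 4 → 𝔼 4) := by
    intro s hs
    rw [orthonormal_iff_ite]
    have hsb : ∀ l l', ⟪Function.update b 0 (s • b 0) l, Function.update b 0 (s • b 0) l'⟫ =
        if l = l' then 1 else 0 := by
      intro l l'
      rcases eq_or_ne l 0 with rfl | hl <;> rcases eq_or_ne l' 0 with rfl | hl'
      · rw [Function.update_self, real_inner_smul_left, real_inner_smul_right, hbb, if_pos rfl,
          mul_one, hs]
      · rw [Function.update_self, Function.update_of_ne hl', real_inner_smul_left, hbb,
          if_neg (Ne.symm hl'), mul_zero]
      · rw [Function.update_self, Function.update_of_ne hl, real_inner_smul_right, hbb,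
          if_neg hl, mul_zero]
      · rw [Function.update_of_ne hl, Function.update_of_ne hl', hbb]
    have hsu : ∀ l, ⟪u, Function.update b 0 (s • b 0) l⟫ = 0 := by
      intro l
      rcases eq_or_ne l 0 with rfl | hl
      · rw [Function.update_self, real_inner_smul_right, hub, mul_zero]
      · rw [Function.update_of_ne hl, hub]
    intro i j
    refine Fin.cases ?_ (fun l ↦ ?_) i <;> refine Fin.cases ?_ (fun l' ↦ ?_) j
    · rw [Matrix.cons_val_zero, if_pos rfl, real_inner_self_eq_norm_sq, hu, one_pow]
    · rw [Matrix.cons_val_zero, Matrix.cons_val_succ, if_neg (Fin.succ_ne_zero l').symm]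
      exact hsu l'
    · rw [Matrix.cons_val_succ, Matrix.cons_val_zero, if_neg (Fin.succ_ne_zero l),
        real_inner_comm]
      exact hsu l
    · rw [Matrix.cons_val_succ, Matrix.cons_val_succ, hsb]
      simp only [Fin.succ_inj]
  -- the determinant is nonzero; choose the sign
  have hb1 : Function.update b 0 ((1 : ℝ) • b 0) = b := by simp
  have hon1 : Orthonormal ℝ (Matrix.vecCons u b : Fin 4 → 𝔼 4) := by
    simpa only [hb1] using hon 1 (by norm_num)
  have hdet0 : (rowMatrix (Matrix.vecCons u b)).det ≠ 0 := by
    intro h0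
    have hrows : LinearIndependent ℝ (rowMatrix (Matrix.vecCons u b)).row := by
      have e : (rowMatrix (Matrix.vecCons u b)).row =
          (WithLp.linearEquiv 2 ℝ (Fin 4 → ℝ)) ∘ (Matrix.vecCons u b : Fin 4 → 𝔼 4) := by
        funext i
        rfl
      rw [e]
      exact hon1.linearIndependent.map' _ (LinearEquiv.ker _)
    exact ((Matrix.isUnit_iff_isUnit_det _).1
      (Matrix.linearIndependent_rows_iff_isUnit.1 hrows)).ne_zero h0
  have hdets : ∀ s : ℝ, (rowMatrix (Matrix.vecCons u (Function.update b 0 (s • b 0)))).det =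
      s * (rowMatrix (Matrix.vecCons u b)).det := by
    intro s
    have e : rowMatrix (Matrix.vecCons u (Function.update b 0 (s • b 0))) =
        Matrix.updateRow (rowMatrix (Matrix.vecCons u b)) 1
          (s • rowMatrix (Matrix.vecCons u b) 1) := by
      ext i j
      rcases Fin.eq_zero_or_eq_succ i with rfl | ⟨l, rfl⟩
      · rw [Matrix.updateRow_ne (show (0 : Fin 4) ≠ 1 by decide)]
        simp [rowMatrix]
      · rcases eq_or_ne l 0 with rfl | hl
        · rw [show ((0 : Fin 3).succ : Fin 4) = 1 from rfl, Matrix.updateRow_self]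
          simp [rowMatrix]
        · have h1 : (l.succ : Fin 4) ≠ 1 := fun h ↦ hl (Fin.succ_injective _ h)
          rw [Matrix.updateRow_ne h1]
          simp [rowMatrix, hl]
    rw [e, Matrix.det_updateRow_smul, Matrix.updateRow_eq_self]
  rcases lt_or_gt_of_ne hdet0 with hlt | hgt
  · refine ⟨⟨u, Function.update b 0 ((-1 : ℝ) • b 0), hon (-1) (by norm_num), ?_⟩, rfl⟩
    rw [hdets]
    linarith
  · refine ⟨⟨u, Function.update b 0 ((1 : ℝ) • b 0), hon 1 (by norm_num), ?_⟩, rfl⟩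
    rw [hdets]
    linarith

/-- Every point of `S³` lies in the domain of a positively oriented hemisphere chart whose pole is
any prescribed unit vector `u` with `⟪u, q⟫ > 0`. [folklore] -/
theorem exists_mem_dom (q : 𝕊 3) : ∃ H : Hemisphere, q ∈ H.dom := by
  obtain ⟨H, hH⟩ := exists_of_norm_eq_one (q : 𝔼 4) (norm_eq_of_mem_sphere q)
  refine ⟨H, ?_⟩
  rw [mem_dom, hH, real_inner_self_eq_norm_sq, norm_eq_of_mem_sphere q]
  norm_num

/-- Two non-antipodal points of `S³` lie in a common hemisphere (pole `(q + q') / ‖q + q'‖`).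
[folklore] -/
theorem exists_mem_dom_and_mem_dom (q q' : 𝕊 3) (h : (q : 𝔼 4) + q' ≠ 0) :
    ∃ H : Hemisphere, q ∈ H.dom ∧ q' ∈ H.dom := by
  set w : 𝔼 4 := (q : 𝔼 4) + q' with hw
  have hw0 : 0 < ‖w‖ := norm_pos_iff.2 h
  obtain ⟨H, hH⟩ := exists_of_norm_eq_one (‖w‖⁻¹ • w) (by
    rw [norm_smul, norm_inv, norm_norm, inv_mul_cancel₀ hw0.ne'])
  have hqq : -1 < ⟪(q : 𝔼 4), (q' : 𝔼 4)⟫ := by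
    -- `⟪q, q'⟫ = -1` forces `q' = -q`
    have h1 : |⟪(q : 𝔼 4), (q' : 𝔼 4)⟫| ≤ 1 := by
      have := abs_real_inner_le_norm (q : 𝔼 4) (q' : 𝔼 4)
      rwa [norm_eq_of_mem_sphere q, norm_eq_of_mem_sphere q', one_mul] at this
    rcases (abs_le.1 h1).1.lt_or_eq with hlt | heq
    · exact hlt
    · exfalso
      apply h
      have hn : ‖(q : 𝔼 4) + q'‖ ^ 2 = 0 := by
        rw [norm_add_sq_real, norm_eq_of_mem_sphere q, norm_eq_of_mem_sphere q', ← heq]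
        norm_num
      exact norm_eq_zero.1 (pow_eq_zero_iff two_ne_zero |>.1 hn)
  have hqq' : -1 < ⟪(q' : 𝔼 4), (q : 𝔼 4)⟫ := by rwa [real_inner_comm]
  refine ⟨H, ?_, ?_⟩
  · rw [mem_dom, hH, real_inner_smul_left, hw, inner_add_left, real_inner_self_eq_norm_sq,
      norm_eq_of_mem_sphere q, one_pow]
    exact mul_pos (inv_pos.2 hw0) (by linarith)
  · rw [mem_dom, hH, real_inner_smul_left, hw, inner_add_left,
      real_inner_self_eq_norm_sq, norm_eq_of_mem_sphere q', one_pow]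
    exact mul_pos (inv_pos.2 hw0) (by linarith)

end Hemisphere

/-! ### Positively oriented germs of maps `ℝ³ → S³ ⊆ ℝ⁴` -/

/-- The standard basis vectors of `ℝ³`. [folklore] -/
abbrev e₃ (i : Fin 3) : 𝔼 3 := EuclideanSpace.basisFun (Fin 3) ℝ i

/-- **A positively oriented germ** of a sphere-valued map at `p ∈ ℝ³`: a map `F : ℝ³ → ℝ⁴`,
continuous, injective and unit-vector valued on the ball `B(p, r)`, Fréchet differentiable at `p`
with derivative `F'`, whose frame `(F p, F' e₀, F' e₁, F' e₂)` has positive determinant — the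
inequality of the orientation convention `Knot.TubularNbhd.det_pos`. [folklore] -/
structure PosGerm where
  /-- The map. -/
  F : 𝔼 3 → 𝔼 4
  /-- The centre. -/
  p : 𝔼 3
  /-- The radius of the ball on which the germ is an embedding into the sphere. -/
  r : ℝ
  /-- The derivative at the centre. -/
  F' : 𝔼 3 →L[ℝ] 𝔼 4
  r_pos : 0 < r
  hasFDerivAt : HasFDerivAt F F' p
  continuousOn : ContinuousOn F (ball p r)
  injOn : InjOn F (ball p r)
  norm_eq : ∀ x ∈ ball p r, ‖F x‖ = 1
  det_pos : 0 < (rowMatrix ![F p, F' (e₃ 0), F' (e₃ 1), F' (e₃ 2)]).det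

namespace PosGerm

variable (G : PosGerm)

/-- The centre belongs to the ball. [folklore] -/
theorem mem_ball : G.p ∈ ball G.p G.r := mem_ball_self G.r_pos

/-- The value at the centre is a unit vector. [folklore] -/
theorem norm_eq_center : ‖G.F G.p‖ = 1 := G.norm_eq _ G.mem_ball

/-- **Tangency**: the derivative of a unit-vector valued map is orthogonal to the map
(differentiate `‖F‖² = 1`). [folklore] -/
theorem inner_F_F' (w : 𝔼 3) : ⟪G.F G.p, G.F' w⟫ = 0 := by
  have h1 : HasFDerivAt (fun x ↦ ‖G.F x‖ ^ 2) (2 • (innerSL ℝ (G.F G.p)).comp G.F') G.p :=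
    G.hasFDerivAt.norm_sq
  have h2 : HasFDerivAt (fun x ↦ ‖G.F x‖ ^ 2) (0 : 𝔼 3 →L[ℝ] ℝ) G.p := by
    refine (hasFDerivAt_const (1 : ℝ) G.p).congr_of_eventuallyEq ?_
    filter_upwards [isOpen_ball.mem_nhds G.mem_ball] with x hx
    rw [G.norm_eq x hx, one_pow]
  have h := h1.unique h2
  have hw := DFunLike.congr_fun h w
  simp only [FunLike.coe_smul, ContinuousLinearMap.coe_comp, Pi.smul_apply,
    Function.comp_apply, innerSL_apply_apply, FunLike.coe_zero, Pi.zero_apply,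
    smul_eq_zero] at hw
  simpa using hw

/-- The centre of the germ, as a point of `S³`. [folklore] -/
def center : 𝕊 3 := ⟨G.F G.p, by rw [mem_sphere_zero_iff_norm, G.norm_eq_center]⟩

/-- The centre as a vector. [folklore] -/
@[simp] theorem coe_center : (G.center : 𝔼 4) = G.F G.p := rfl

/-- The germ as a continuous map from the ball to `S³`. [folklore] -/
def sphereMap : C(↥(ball G.p G.r), 𝕊 3) where
  toFun x := ⟨G.F x, by rw [mem_sphere_zero_iff_norm, G.norm_eq x x.2]⟩
  continuous_toFun := by
    refine Continuous.subtype_mk ?_ _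
    exact G.continuousOn.comp_continuous continuous_subtype_val fun x ↦ x.2

/-- The sphere-valued germ as a vector-valued function. [folklore] -/
@[simp] theorem coe_sphereMap (x : ↥(ball G.p G.r)) : (G.sphereMap x : 𝔼 4) = G.F x := rfl

/-- The centre of the ball. [folklore] -/
def pt : ↥(ball G.p G.r) := ⟨G.p, G.mem_ball⟩

/-- The germ maps the centre of the ball to the centre of the germ. [folklore] -/
theorem sphereMap_pt : G.sphereMap G.pt = G.center := rfl

/-- Only the centre of the ball is mapped to the centre of the germ (injectivity). [folklore] -/
theorem mapsTo_sphereMap : MapsTo G.sphereMap ({G.pt}ᶜ : Set ↥(ball G.p G.r)) ({G.center}ᶜ : Set (𝕊 3)) := by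
  intro x hx h
  apply hx
  have h' : G.F x = G.F G.p := congrArg Subtype.val h
  exact Subtype.ext (G.injOn x.2 G.mem_ball h')

/-- **The reference generator at the centre**, `μ_E(p)` read in the local homology of the ball.
[folklore] -/
def gen : localHomology ℤ ℤ (↥(ball G.p G.r)) G.pt 3 :=
  (localHomology.openSubsetIso ℤ ℤ isOpen_ball G.mem_ball 3).inv ((μE 3).localClass G.p)

/-- **The local class transported by the germ**: the image of `μ_E(p)` in `H₃(S³ | F p; ℤ)`.
[folklore] -/
def push : localHomology ℤ ℤ (𝕊 3) G.center 3 :=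
  relativeSingularHomology.map ℤ ℤ G.sphereMap G.mapsTo_sphereMap 3 G.gen

/-! #### The chart of a germ landing in a hemisphere -/

variable (H : Hemisphere)

/-- The germ read in the hemisphere chart: `x ↦ (⟪b j, F x⟫)_j : ℝ³ → ℝ³`. [folklore] -/
def chartMap : 𝔼 3 → 𝔼 3 := fun x ↦ H.coordL (G.F x)

/-- The derivative of the germ read in a hemisphere chart (chain rule with the linear chart). [folklore] -/
theorem hasFDerivAt_chartMap : HasFDerivAt (G.chartMap H) (H.coordL.comp G.F') G.p :=
  H.coordL.hasFDerivAt.comp G.p G.hasFDerivAt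

/-- The frame of the germ, as a family of four vectors. [folklore] -/
def frame : Fin 4 → 𝔼 4 := ![G.F G.p, G.F' (e₃ 0), G.F' (e₃ 1), G.F' (e₃ 2)]

/-- The first frame vector is the value at the centre. [folklore] -/
theorem frame_zero : G.frame 0 = G.F G.p := rfl

/-- The further frame vectors are the partial derivatives. [folklore] -/
theorem frame_succ (i : Fin 3) : G.frame i.succ = G.F' (e₃ i) := by
  fin_cases i <;> rfl

/-- **The Jacobian of the germ in a hemisphere chart is positive** whenever the centre lies in the
hemisphere: its matrix in the standard basis is the minor `(⟪b l, F' e_i⟫)` of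
`Hemisphere.det_minor_pos`. [folklore] -/
theorem det_coordL_comp_pos (hp : 0 < ⟪H.u, G.F G.p⟫) : 0 < (H.coordL.comp G.F').det := by
  have hmat : LinearMap.toMatrix (EuclideanSpace.basisFun (Fin 3) ℝ).toBasis
      (EuclideanSpace.basisFun (Fin 3) ℝ).toBasis ((H.coordL.comp G.F' : 𝔼 3 →L[ℝ] 𝔼 3) : 𝔼 3 →ₗ[ℝ] 𝔼 3)
      = Matrix.of fun l i : Fin 3 ↦ ⟪H.basis l.succ, G.frame i.succ⟫ := by
    ext l i
    rw [LinearMap.toMatrix_apply, OrthonormalBasis.coe_toBasis_repr_apply, OrthonormalBasis.coe_toBasis,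
      EuclideanSpace.basisFun_repr, Matrix.of_apply, H.basis_succ, G.frame_succ]
    exact H.coordL_apply _ _
  have hdet : (H.coordL.comp G.F').det = (Matrix.of fun l i : Fin 3 ↦ ⟪H.basis l.succ, G.frame i.succ⟫).det := by
    rw [ContinuousLinearMap.det, ← LinearMap.det_toMatrix (EuclideanSpace.basisFun (Fin 3) ℝ).toBasis, hmat]
  rw [hdet]
  refine det_minor_pos H.basis G.frame ?_ ?_ ?_ ?_ ?_
  · have e : rowMatrix ⇑H.basis = rowMatrix (Matrix.vecCons H.u H.b) := by
      ext k j; simp [rowMatrix]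
    rw [e]
    exact H.det_pos
  · rw [frame_zero, G.norm_eq_center]
  · rwa [H.basis_zero, frame_zero]
  · intro i
    rw [frame_zero, frame_succ]
    exact G.inner_F_F' _
  · exact G.det_pos

end PosGerm

/-! ### Tube germs: the parametrisation `ℝ³ → S¹ × ℝ²` and oriented tubular neighbourhoods -/

/-- The last two coordinates of a vector of `ℝ³`, a continuous linear map `ℝ³ → ℝ²`. [folklore] -/
def tail₂L : 𝔼 3 →L[ℝ] 𝔼 2 :=
  (EuclideanSpace.equiv (Fin 2) ℝ).symm.toContinuousLinearMap.comp
    (ContinuousLinearMap.pi fun i : Fin 2 ↦ EuclideanSpace.proj (i.succ : Fin 3))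

/-- The tail map as a function. [folklore] -/
@[simp] theorem tail₂L_apply (x : 𝔼 3) (i : Fin 2) : tail₂L x i = x i.succ := by
  simp [tail₂L]

/-- The point of `ℝ³` with first coordinate `t` and tail `w`. [folklore] -/
def mk3 (t : ℝ) (w : 𝔼 2) : 𝔼 3 := WithLp.toLp 2 ![t, w 0, w 1]

/-- The first coordinate of `mk3 t w` is `t`. [folklore] -/
@[simp] theorem mk3_zero (t : ℝ) (w : 𝔼 2) : mk3 t w 0 = t := rfl

/-- The tail of `mk3 t w` is `w`. [folklore] -/
@[simp] theorem tail₂L_mk3 (t : ℝ) (w : 𝔼 2) : tail₂L (mk3 t w) = w := by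
  ext i
  rw [tail₂L_apply]
  fin_cases i <;> rfl

/-- Every vector of `ℝ³` is `mk3` of its first coordinate and its tail. [folklore] -/
theorem mk3_eq (x : 𝔼 3) : mk3 (x 0) (tail₂L x) = x := by
  ext i
  fin_cases i
  · rfl
  · show (tail₂L x) 0 = x 1
    rw [tail₂L_apply]; rfl
  · show (tail₂L x) 1 = x 2
    rw [tail₂L_apply]; rfl

/-- Moving the first coordinate is a translation along `e₀`. [folklore] -/
theorem mk3_add_smul_zero (θ t : ℝ) (w : 𝔼 2) : mk3 t w = mk3 θ w + (t - θ) • e₃ 0 := by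
  ext i
  fin_cases i <;> simp [mk3, e₃, EuclideanSpace.basisFun_apply]

/-- Moving a tail coordinate is a translation along `e₁` or `e₂`. [folklore] -/
theorem mk3_add_single (θ s : ℝ) (w : 𝔼 2) (i : Fin 2) :
    mk3 θ (w + EuclideanSpace.single i s) = mk3 θ w + s • e₃ i.succ := by
  ext j
  fin_cases i <;> fin_cases j <;> simp [mk3, e₃, EuclideanSpace.basisFun_apply]

/-- **The parametrisation `ℝ³ → S¹ × ℝ²`**, `x ↦ (e^{i x₀}, (x₁, x₂))`. [folklore] -/
def tubeParam (x : 𝔼 3) : (𝕊 1) × 𝔼 2 := (circlePoint (x 0), tail₂L x)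

/-- The parametrisation on `mk3 t w`. [folklore] -/
theorem tubeParam_mk3 (t : ℝ) (w : 𝔼 2) : tubeParam (mk3 t w) = (circlePoint t, w) := by
  rw [tubeParam, mk3_zero, tail₂L_mk3]

/-- The parametrisation is continuous. [folklore] -/
theorem continuous_tubeParam : Continuous tubeParam := by
  have h0 : Continuous (fun x : 𝔼 3 ↦ x 0) := (EuclideanSpace.proj (0 : Fin 3) : 𝔼 3 →L[ℝ] ℝ).continuous
  exact (continuous_circlePoint.comp h0).prodMk tail₂L.continuous

/-- The parametrisation is smooth. [folklore] -/
theorem contMDiff_tubeParam : ContMDiff 𝓘(ℝ, 𝔼 3) ((𝓡 1).prod 𝓘(ℝ, 𝔼 2)) ∞ tubeParam := by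
  have h0 : ContDiff ℝ ∞ (fun x : 𝔼 3 ↦ x 0) := (EuclideanSpace.proj (0 : Fin 3) : 𝔼 3 →L[ℝ] ℝ).contDiff
  have h1 : ContMDiff 𝓘(ℝ, 𝔼 3) (𝓡 1) ∞ (fun x : 𝔼 3 ↦ circlePoint (x 0)) :=
    contMDiff_circlePoint.comp h0.contMDiff
  have h2 : ContMDiff 𝓘(ℝ, 𝔼 3) 𝓘(ℝ, 𝔼 2) ∞ (fun x : 𝔼 3 ↦ tail₂L x) := tail₂L.contDiff.contMDiff
  exact h1.prodMk h2

/-- The parametrisation is onto. [folklore] -/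
theorem tubeParam_surjective : Function.Surjective tubeParam := by
  rintro ⟨x, w⟩
  obtain ⟨t, rfl⟩ := circlePoint_surjective x
  exact ⟨mk3 t w, tubeParam_mk3 t w⟩

/-- `tubeParam` is injective on every ball of radius `1` (`< π`). [folklore] -/
theorem tubeParam_injOn (p : 𝔼 3) : InjOn tubeParam (ball p 1) := by
  intro x hx x' hx' h
  simp only [tubeParam, Prod.mk.injEq] at h
  obtain ⟨h1, h2⟩ := h
  obtain ⟨k, hk⟩ := exists_eq_add_of_circlePoint_eq h1
  have hd : |x 0 - x' 0| < 2 := by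
    have h3 : dist x x' < 2 := by
      calc dist x x' ≤ dist x p + dist p x' := dist_triangle _ _ _
        _ < 1 + 1 := add_lt_add (mem_ball.1 hx) (by rw [dist_comm]; exact mem_ball.1 hx')
        _ = 2 := by norm_num
    exact lt_of_le_of_lt (by simpa [Real.dist_eq] using PiLp.dist_apply_le x x' 0) h3
  have hk0 : k = 0 := by
    rw [hk, add_sub_cancel_left, abs_mul, abs_of_pos Real.two_pi_pos] at hd
    by_contra hk0
    have h1k : (1 : ℝ) ≤ |(k : ℝ)| := by
      rw [← Int.cast_abs]
      exact_mod_cast Int.one_le_abs hk0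
    nlinarith [Real.pi_gt_three, abs_nonneg (k : ℝ)]
  rw [hk0, Int.cast_zero, zero_mul, add_zero] at hk
  rw [← mk3_eq x, ← mk3_eq x', hk, h2]

namespace Knot.TubularNbhd

variable {K : Knot} (ν : Knot.TubularNbhd K)

/-- An oriented tubular neighbourhood, composed with `tubeParam` and the inclusion `S³ ⊆ ℝ⁴`:
`F_ν (t, w) = ν (e^{it}, w) ∈ ℝ⁴`. [folklore] -/
def liftE (x : 𝔼 3) : 𝔼 4 := (ν (tubeParam x) : 𝔼 4)

/-- Unfolding of `liftE`. [folklore] -/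
theorem liftE_apply (x : 𝔼 3) : ν.liftE x = (ν (tubeParam x) : 𝔼 4) := rfl

/-- `F_ν (t, w) = ν (e^{it}, w)`. [folklore] -/
theorem liftE_mk3 (t : ℝ) (w : 𝔼 2) : ν.liftE (mk3 t w) = (ν (circlePoint t, w) : 𝔼 4) := by
  rw [liftE_apply, tubeParam_mk3]

/-- `F_ν` is smooth (composition of smooth maps of manifolds, read in vector spaces). [folklore] -/
theorem contDiff_liftE : ContDiff ℝ ∞ ν.liftE := by
  have h1 : ContMDiff 𝓘(ℝ, 𝔼 3) (𝓡 3) ∞ (fun x ↦ ν (tubeParam x)) :=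
    ν.isSmoothEmbedding.contMDiff.comp contMDiff_tubeParam
  have h2 : ContMDiff (𝓡 3) 𝓘(ℝ, EuclideanSpace ℝ (Fin (3 + 1))) ∞
      (Subtype.val : (𝕊 3) → EuclideanSpace ℝ (Fin (3 + 1))) :=
    contMDiff_coe_sphere (E := EuclideanSpace ℝ (Fin (3 + 1))) (n := 3)
  exact contMDiff_iff_contDiff.1 (h2.comp h1)

/-- `F_ν` is differentiable. [folklore] -/
theorem differentiable_liftE : Differentiable ℝ ν.liftE :=
  ν.contDiff_liftE.differentiable (by simp)

/-- `F_ν` is unit-vector valued. [folklore] -/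
theorem norm_liftE (x : 𝔼 3) : ‖ν.liftE x‖ = 1 := by
  rw [liftE_apply, norm_eq_of_mem_sphere]

/-- `F_ν` is injective on balls of radius `1`. [folklore] -/
theorem liftE_injOn (p : 𝔼 3) : InjOn ν.liftE (ball p 1) := fun _ hx _ hx' h ↦
  tubeParam_injOn p hx hx' (ν.isOpenEmbedding.injective (Subtype.ext h))

/-- The three partial derivatives of `F_ν` at `p` are the `deriv`s of the field `det_pos`.
[folklore] -/
theorem fderiv_liftE_e₀ (p : 𝔼 3) :
    fderiv ℝ ν.liftE p (e₃ 0) = deriv (fun t : ℝ ↦ (ν (circlePoint t, tail₂L p) : 𝔼 4)) (p 0) := by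
  have hc : HasDerivAt (fun t : ℝ ↦ mk3 t (tail₂L p)) (e₃ 0) (p 0) := by
    have h : (fun t : ℝ ↦ mk3 t (tail₂L p)) = fun t ↦ mk3 (p 0) (tail₂L p) + (t - p 0) • e₃ 0 :=
      funext fun t ↦ mk3_add_smul_zero (p 0) t (tail₂L p)
    rw [h]
    simpa using (((hasDerivAt_id (p 0)).sub_const (p 0)).smul_const (e₃ 0)).const_add
      (mk3 (p 0) (tail₂L p))
  have hfun : (fun t : ℝ ↦ (ν (circlePoint t, tail₂L p) : 𝔼 4)) = ν.liftE ∘ fun t ↦ mk3 t (tail₂L p) := by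
    funext t
    exact (ν.liftE_mk3 t (tail₂L p)).symm
  rw [hfun, ((ν.differentiable_liftE _).hasFDerivAt.comp_hasDerivAt (p 0) hc).deriv, mk3_eq]

/-- The fibre partial derivatives of `F_ν` at `p` are the fibre `deriv`s of the field `det_pos`. [folklore] -/
theorem fderiv_liftE_e_succ (p : 𝔼 3) (i : Fin 2) :
    fderiv ℝ ν.liftE p (e₃ i.succ) =
      deriv (fun s : ℝ ↦ (ν (circlePoint (p 0), tail₂L p + EuclideanSpace.single i s) : 𝔼 4)) 0 := by
  have hc : HasDerivAt (fun s : ℝ ↦ mk3 (p 0) (tail₂L p + EuclideanSpace.single i s)) (e₃ i.succ) 0 := by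
    have h : (fun s : ℝ ↦ mk3 (p 0) (tail₂L p + EuclideanSpace.single i s)) =
        fun s ↦ mk3 (p 0) (tail₂L p) + s • e₃ i.succ :=
      funext fun s ↦ mk3_add_single (p 0) s (tail₂L p) i
    rw [h]
    simpa using ((hasDerivAt_id (0 : ℝ)).smul_const (e₃ i.succ)).const_add (mk3 (p 0) (tail₂L p))
  have hfun : (fun s : ℝ ↦ (ν (circlePoint (p 0), tail₂L p + EuclideanSpace.single i s) : 𝔼 4)) =
      ν.liftE ∘ fun s ↦ mk3 (p 0) (tail₂L p + EuclideanSpace.single i s) := by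
    funext s
    exact (ν.liftE_mk3 _ _).symm
  have hp : mk3 (p 0) (tail₂L p + EuclideanSpace.single i 0) = p := by
    rw [show EuclideanSpace.single i (0 : ℝ) = 0 by simp, add_zero, mk3_eq]
  have hd : HasFDerivAt ν.liftE (fderiv ℝ ν.liftE p) (mk3 (p 0) (tail₂L p + EuclideanSpace.single i 0)) := by
    rw [hp]
    exact (ν.differentiable_liftE _).hasFDerivAt
  rw [hfun, (hd.comp_hasDerivAt (0 : ℝ) hc).deriv]

/-- **The frame determinant of `F_ν` is positive** (the field `det_pos` of `ν`). [folklore] -/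
theorem det_frame_liftE_pos (p : 𝔼 3) :
    0 < (rowMatrix ![ν.liftE p, fderiv ℝ ν.liftE p (e₃ 0), fderiv ℝ ν.liftE p (e₃ 1),
      fderiv ℝ ν.liftE p (e₃ 2)]).det := by
  have h := ν.det_pos (p 0) (tail₂L p)
  have e1 : fderiv ℝ ν.liftE p (e₃ 1) =
      deriv (fun s : ℝ ↦ (ν (circlePoint (p 0), tail₂L p + EuclideanSpace.single 0 s) : 𝔼 4)) 0 :=
    ν.fderiv_liftE_e_succ p 0
  have e2 : fderiv ℝ ν.liftE p (e₃ 2) =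
      deriv (fun s : ℝ ↦ (ν (circlePoint (p 0), tail₂L p + EuclideanSpace.single 1 s) : 𝔼 4)) 0 :=
    ν.fderiv_liftE_e_succ p 1
  rw [rowMatrix_eq_of, fderiv_liftE_e₀, e1, e2, liftE_apply]
  exact h

/-- **The positively oriented germ of an oriented tubular neighbourhood** at `p ∈ ℝ³`, of radius
`r ≤ 1`. [folklore] -/
def germ (p : 𝔼 3) (r : ℝ) (hr : 0 < r) (hr1 : r ≤ 1) : PosGerm where
  F := ν.liftE
  p := p
  r := r
  F' := fderiv ℝ ν.liftE p
  r_pos := hr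
  hasFDerivAt := (ν.differentiable_liftE p).hasFDerivAt
  continuousOn := ν.contDiff_liftE.continuous.continuousOn
  injOn := (ν.liftE_injOn p).mono (ball_subset_ball hr1)
  norm_eq x _ := ν.norm_liftE x
  det_pos := ν.det_frame_liftE_pos p

/-- The map of the tube germ. [folklore] -/
@[simp] theorem germ_F (p : 𝔼 3) (r : ℝ) (hr : 0 < r) (hr1 : r ≤ 1) : (ν.germ p r hr hr1).F = ν.liftE := rfl
/-- The centre of the tube germ. [folklore] -/
@[simp] theorem germ_p (p : 𝔼 3) (r : ℝ) (hr : 0 < r) (hr1 : r ≤ 1) : (ν.germ p r hr hr1).p = p := rfl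
/-- The radius of the tube germ. [folklore] -/
@[simp] theorem germ_r (p : 𝔼 3) (r : ℝ) (hr : 0 < r) (hr1 : r ≤ 1) : (ν.germ p r hr hr1).r = r := rfl

/-- The centre of the tube germ on the sphere is `ν (tubeParam p)`. [folklore] -/
theorem germ_center (p : 𝔼 3) (r : ℝ) (hr : 0 < r) (hr1 : r ≤ 1) :
    (ν.germ p r hr hr1).center = ν (tubeParam p) := rfl

end Knot.TubularNbhd

/-! ### One sign for each hemisphere -/

section Sign

variable {X Y : Type u} [TopologicalSpace X] [TopologicalSpace Y]

/-- Changing the source point of an induced map on local homology along an equality of points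
(the map, the target point and the class move together). [folklore] -/
theorem map_localClass_eq_of_eq {n : ℕ} (ν : HomologicalOrientation ℤ X n) (f : C(X, Y))
    {x x' : X} (hx : x = x') {y : Y} (h : MapsTo f ({x}ᶜ : Set X) ({y}ᶜ : Set Y))
    (h' : MapsTo f ({x'}ᶜ : Set X) ({y}ᶜ : Set Y)) :
    relativeSingularHomology.map ℤ ℤ f h n (ν.localClass x) =
      relativeSingularHomology.map ℤ ℤ f h' n (ν.localClass x') := by
  subst hx
  rfl

end Sign

/-- **The reference orientation of the open unit ball of `ℝ³`** (the restriction of the reference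
orientation `μ_E` of `ℝ³`, `HomologicalOrientationOfSmooth.μE`). [folklore] -/
def ballOrientation : HomologicalOrientation ℤ (↥(ball (0 : 𝔼 3) 1)) 3 :=
  (μE 3).ofIsOpen isOpen_ball

/-- Unfolding of the reference orientation of the ball. [folklore] -/
theorem ballOrientation_localClass (y : ↥(ball (0 : 𝔼 3) 1)) :
    ballOrientation.localClass y =
      (localHomology.openSubsetIso ℤ ℤ isOpen_ball y.2 3).inv ((μE 3).localClass (y : 𝔼 3)) :=
  rfl

namespace Hemisphere

variable (H : Hemisphere) (μ : HomologicalOrientation ℤ (𝕊 3) 3)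

/-- The orientation `μ` of `S³` restricted to the hemisphere. [folklore] -/
def domOrientation : HomologicalOrientation ℤ (↥H.dom) 3 := μ.ofIsOpen H.isOpen_dom

/-- The orientation `μ` of the hemisphere, transported to the unit ball of `ℝ³` by the chart.
[folklore] -/
def transported : HomologicalOrientation ℤ (↥(ball (0 : 𝔼 3) 1)) 3 :=
  (H.domOrientation μ).comap H.homeo.symm

/-- Only `c⁻¹ y` is mapped to `y` by the chart. [folklore] -/
theorem mapsTo_homeo (y : ↥(ball (0 : 𝔼 3) 1)) :
    MapsTo (H.homeo : C(↥H.dom, ↥(ball (0 : 𝔼 3) 1))) ({H.homeo.symm y}ᶜ : Set ↥H.dom)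
      ({y}ᶜ : Set ↥(ball (0 : 𝔼 3) 1)) :=
  Literature.AlgebraicTopology.SingularHomology.mapsTo_compl_singleton_of_injective H.homeo.injective (H.homeo.apply_symm_apply y)

/-- The transported orientation at `y` is the chart image of `μ` at `c⁻¹ y`. [folklore] -/
theorem transported_localClass (y : ↥(ball (0 : 𝔼 3) 1)) :
    (H.transported μ).localClass y =
      relativeSingularHomology.map ℤ ℤ (H.homeo : C(↥H.dom, ↥(ball (0 : 𝔼 3) 1))) (H.mapsTo_homeo y) 3
        ((H.domOrientation μ).localClass (H.homeo.symm y)) := by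
  rw [transported, HomologicalOrientation.comap_localClass]
  rfl

/-- **The transported orientation is `±` the reference orientation of the ball**, with one sign for
the whole (connected) ball: Hatcher 2002, §3.3 p. 234, two orientations of a connected manifold
agree or are opposite (tree: `eq_or_eq_neg_of_connected_holds`). [cite: HatcherAT2002, §3.3 p. 234] -/
theorem exists_sign : ∃ s : ℤ, s * s = 1 ∧ ∀ y : ↥(ball (0 : 𝔼 3) 1),
    (H.transported μ).localClass y = s • ballOrientation.localClass y := by
  haveI : ChartedSpace (𝔼 3) ↥(ball (0 : 𝔼 3) 1) := inferInstanceAs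
    (ChartedSpace (𝔼 3) ↥(⟨ball 0 1, isOpen_ball⟩ : TopologicalSpace.Opens (𝔼 3)))
  haveI : ConnectedSpace ↥(ball (0 : 𝔼 3) 1) := isConnected_iff_connectedSpace.1
    ((convex_ball (0 : 𝔼 3) 1).isConnected ⟨0, mem_ball_self one_pos⟩)
  rcases HomologicalOrientation.eq_or_eq_neg_of_connected_holds (↥(ball (0 : 𝔼 3) 1))
    (H.transported μ) ballOrientation with h | h
  · exact ⟨1, by norm_num, fun y ↦ by rw [h, one_smul]⟩
  · exact ⟨-1, by norm_num, fun y ↦ by rw [h, HomologicalOrientation.neg_localClass, neg_one_zsmul]⟩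

end Hemisphere

/-! ### The local class transported by a positively oriented germ -/

namespace PosGerm

variable (G : PosGerm) (H : Hemisphere) (μ : HomologicalOrientation ℤ (𝕊 3) 3)

/-- The germ, landing in the hemisphere. [folklore] -/
def hemiMap (hdom : ∀ x ∈ ball G.p G.r, 0 < ⟪H.u, G.F x⟫) : C(↥(ball G.p G.r), ↥H.dom) where
  toFun x := ⟨G.sphereMap x, hdom x x.2⟩
  continuous_toFun := Continuous.subtype_mk G.sphereMap.continuous _

/-- **The germ transports the reference generator to `σ_H · μ`**: for a positively oriented germ
`F` whose ball maps into the hemisphere `H`, the image `F_* μ_E(p) ∈ H₃(S³ | F p; ℤ)` is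
`σ • μ_{F p}`, where `σ = ±1` is the sign comparing, on the ball of `ℝ³`, the orientation `μ` read in
the chart `c_H` with the reference orientation `μ_E` (`Hemisphere.exists_sign`). Proof: the chart
composite `c_H ∘ F` is a local homeomorphism of `ℝ³` with positive Jacobian at `p`
(`det_coordL_comp_pos`), hence acts on `H₃(ℝ³ | p)` as its derivative (linearisation,
`openSubsetIso_map_eq_map_affine`; Bredon 1993, VI.7, proof of Thm. 7.15) which preserves `μ_E`
(`pres_of_affine`).
[cite: Bredon1993, VI.7 Thm. 7.15 (proof)] -/
theorem push_eq (hdom : ∀ x ∈ ball G.p G.r, 0 < ⟪H.u, G.F x⟫) {s : ℤ} (hs : s * s = 1)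
    (hsign : ∀ y : ↥(ball (0 : 𝔼 3) 1),
      (H.transported μ).localClass y = s • ballOrientation.localClass y) :
    G.push = s • μ.localClass G.center := by
  -- the maps
  set g₀ : C(↥(ball G.p G.r), ↥H.dom) := G.hemiMap H hdom with hg₀
  set q' : ↥H.dom := g₀ G.pt with hq'
  set gB : C(↥(ball G.p G.r), ↥(ball (0 : 𝔼 3) 1)) :=
    (H.homeo : C(↥H.dom, ↥(ball (0 : 𝔼 3) 1))).comp g₀ with hgB
  set y : ↥(ball (0 : 𝔼 3) 1) := gB G.pt with hy
  have hyq : y = H.homeo q' := rfl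
  have hq'c : (q' : 𝕊 3) = G.center := rfl
  -- injectivity
  have hg₀inj : Function.Injective g₀ := by
    intro x x' h
    have h' : G.F x = G.F x' := congrArg (fun z : ↥H.dom ↦ ((z : 𝕊 3) : 𝔼 4)) h
    exact Subtype.ext (G.injOn x.2 x'.2 h')
  have hgBinj : Function.Injective gB := H.homeo.injective.comp hg₀inj
  have hgBG : ∀ w : ↥(ball G.p G.r), (gB w : 𝔼 3) = G.chartMap H w := fun w ↦ rfl
  -- the derivative of the chart map
  set A : 𝔼 3 →L[ℝ] 𝔼 3 := H.coordL.comp G.F' with hA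
  have hAdet : 0 < A.det := G.det_coordL_comp_pos H (hdom G.p G.mem_ball)
  have hAinj : Function.Injective A := by
    have hne : LinearMap.det (A : 𝔼 3 →ₗ[ℝ] 𝔼 3) ≠ 0 := hAdet.ne'
    exact (LinearMap.equivOfDetNeZero (A : 𝔼 3 →ₗ[ℝ] 𝔼 3) hne).injective
  have hGy : G.chartMap H G.p = y := rfl
  have h₁ : MapsTo gB ({G.pt}ᶜ : Set ↥(ball G.p G.r)) ({y}ᶜ : Set ↥(ball (0 : 𝔼 3) 1)) :=
    Literature.AlgebraicTopology.SingularHomology.mapsTo_compl_singleton_of_injective hgBinj rfl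
  have h₂ : MapsTo (affineApprox (y : 𝔼 3) (G.pt : 𝔼 3) A) ({(G.pt : 𝔼 3)}ᶜ : Set (𝔼 3))
      ({(y : 𝔼 3)}ᶜ : Set (𝔼 3)) := by
    intro z hz hzy
    apply hz
    have h0 : A (z - G.p) = 0 := by
      have : (y : 𝔼 3) + A (z - G.p) = y := hzy
      simpa using this
    have := hAinj (h0.trans (map_zero A).symm)
    exact sub_eq_zero.1 this
  -- linearisation
  have lin := openSubsetIso_map_eq_map_affine isOpen_ball isOpen_ball gB hgBinj hgBG G.pt y
    (show HasFDerivAt (G.chartMap H) A G.pt from G.hasFDerivAt_chartMap H) hAinj hGy h₁ h₂ 3 G.gen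
  have hgen : (localHomology.openSubsetIso ℤ ℤ isOpen_ball G.pt.2 3).hom G.gen = (μE 3).localClass G.p :=
    Iso.inv_hom_id_apply _ _
  rw [hgen] at lin
  -- the affine approximation preserves `μ_E`
  set e : 𝔼 3 ≃ₜ 𝔼 3 := (clmHomeo A hAdet.ne').trans (Homeomorph.addRight ((y : 𝔼 3) - A G.p)) with he
  have he' : ∀ z, e z = A z + ((y : 𝔼 3) - A G.p) := fun z ↦ by
    simp [he, Homeomorph.trans_apply]
  have hpres := pres_of_affine e A hAdet ((y : 𝔼 3) - A G.p) he'
  have hef : (e : C(𝔼 3, 𝔼 3)) = affineApprox (y : 𝔼 3) (G.pt : 𝔼 3) A := by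
    ext1 z
    show e z = affineApprox (y : 𝔼 3) G.p A z
    rw [he', affineApprox_apply, map_sub]
    abel
  have h₃ : MapsTo (e : C(𝔼 3, 𝔼 3)) ({(G.pt : 𝔼 3)}ᶜ : Set (𝔼 3)) ({(y : 𝔼 3)}ᶜ : Set (𝔼 3)) := by
    rw [hef]; exact h₂
  have haff : relativeSingularHomology.map ℤ ℤ (affineApprox (y : 𝔼 3) (G.pt : 𝔼 3) A) h₂ 3
      ((μE 3).localClass G.p) = (μE 3).localClass (y : 𝔼 3) := by
    rw [← map_congr_fun hef h₃ h₂ 3]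
    exact hpres h₃
  rw [haff] at lin
  -- hence `gB_* gen = ballOrientation y`
  have hB : relativeSingularHomology.map ℤ ℤ gB h₁ 3 G.gen = ballOrientation.localClass y := by
    rw [ballOrientation_localClass, ← lin, Iso.hom_inv_id_apply]
  -- split `gB = homeo ∘ g₀`
  have hg₀m : MapsTo g₀ ({G.pt}ᶜ : Set ↥(ball G.p G.r)) ({q'}ᶜ : Set ↥H.dom) :=
    Literature.AlgebraicTopology.SingularHomology.mapsTo_compl_singleton_of_injective hg₀inj rfl
  have hhm : MapsTo (H.homeo : C(↥H.dom, ↥(ball (0 : 𝔼 3) 1))) ({q'}ᶜ : Set ↥H.dom)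
      ({y}ᶜ : Set ↥(ball (0 : 𝔼 3) 1)) :=
    Literature.AlgebraicTopology.SingularHomology.mapsTo_compl_singleton_of_injective H.homeo.injective rfl
  have hsplit : relativeSingularHomology.map ℤ ℤ gB h₁ 3 G.gen =
      relativeSingularHomology.map ℤ ℤ (H.homeo : C(↥H.dom, ↥(ball (0 : 𝔼 3) 1))) hhm 3
        (relativeSingularHomology.map ℤ ℤ g₀ hg₀m 3 G.gen) := by
    rw [← ModuleCat.comp_apply, ← relativeSingularHomology.map_comp]
  -- the sign at `y`
  have hsy : relativeSingularHomology.map ℤ ℤ (H.homeo : C(↥H.dom, ↥(ball (0 : 𝔼 3) 1))) hhm 3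
      ((H.domOrientation μ).localClass q') = s • ballOrientation.localClass y := by
    rw [← hsign y, H.transported_localClass μ y]
    exact (map_localClass_eq_of_eq (H.domOrientation μ) _ (H.homeo.symm_apply_apply q')
      (H.mapsTo_homeo y) hhm).symm
  -- injectivity of `homeo_*`
  have hinj : Function.Injective (relativeSingularHomology.map ℤ ℤ
      (H.homeo : C(↥H.dom, ↥(ball (0 : 𝔼 3) 1))) hhm 3) := by
    have : IsIso (relativeSingularHomology.map ℤ ℤ
        (H.homeo : C(↥H.dom, ↥(ball (0 : 𝔼 3) 1))) hhm 3) :=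
      (inferInstance : IsIso (localHomology.mapIso ℤ ℤ H.homeo q' 3).hom)
    exact (ModuleCat.mono_iff_injective _).1 inferInstance
  have hg₀gen : relativeSingularHomology.map ℤ ℤ g₀ hg₀m 3 G.gen =
      s • (H.domOrientation μ).localClass q' := by
    apply hinj
    rw [← hsplit, hB, map_zsmul, hsy, smul_smul, hs, one_smul]
  -- back to `S³`
  have hsm : MapsTo (subsetIncl H.dom) ({q'}ᶜ : Set ↥H.dom) ({G.center}ᶜ : Set (𝕊 3)) :=
    fun z hz hzq ↦ hz (Subtype.ext hzq)
  have hpush : G.push = relativeSingularHomology.map ℤ ℤ (subsetIncl H.dom) hsm 3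
      (relativeSingularHomology.map ℤ ℤ g₀ hg₀m 3 G.gen) := by
    rw [push, ← ModuleCat.comp_apply, ← relativeSingularHomology.map_comp]
    rfl
  rw [hpush, hg₀gen, map_zsmul]
  congr 1
  exact openSubsetIso_hom_ofIsOpen_localClass μ H.isOpen_dom q'

end PosGerm

/-! ### The main theorem: all oriented tubes transport the same local orientation -/

namespace Knot.TubularNbhd

variable {K : Knot} (ν : Knot.TubularNbhd K)

/-- The tubular neighbourhood map as a continuous map `S¹ × ℝ² → S³`. [folklore] -/
def toCMap : C((𝕊 1) × 𝔼 2, 𝕊 3) := ⟨ν, ν.isOpenEmbedding.continuous⟩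

/-- The continuous map of `ν` as a function. [folklore] -/
@[simp] theorem toCMap_apply (m : (𝕊 1) × 𝔼 2) : ν.toCMap m = ν m := rfl

/-- Only `m` is mapped to `ν m` (injectivity). [folklore] -/
theorem mapsTo_toCMap (m : (𝕊 1) × 𝔼 2) :
    MapsTo ν.toCMap ({m}ᶜ : Set ((𝕊 1) × 𝔼 2)) ({ν m}ᶜ : Set (𝕊 3)) :=
  Literature.AlgebraicTopology.SingularHomology.mapsTo_compl_singleton_of_injective ν.isOpenEmbedding.injective rfl

end Knot.TubularNbhd

/-- `tubeParam` restricted to a ball, as a continuous map. [folklore] -/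
def tubeParamBall (p : 𝔼 3) (r : ℝ) : C(↥(ball p r), (𝕊 1) × 𝔼 2) :=
  ⟨fun x ↦ tubeParam x, continuous_tubeParam.comp continuous_subtype_val⟩

/-- The centre of a ball of positive radius, as a point of the ball. [folklore] -/
def ballCenter₃ (p : 𝔼 3) {r : ℝ} (hr : 0 < r) : ↥(ball p r) := ⟨p, mem_ball_self hr⟩

/-- Only the centre of a ball of radius `≤ 1` is mapped to its image by `tubeParam` (injectivity). [folklore] -/
theorem mapsTo_tubeParamBall (p : 𝔼 3) {r : ℝ} (hr : 0 < r) (hr1 : r ≤ 1) :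
    MapsTo (tubeParamBall p r) ({ballCenter₃ p hr}ᶜ : Set ↥(ball p r))
      ({tubeParam p}ᶜ : Set ((𝕊 1) × 𝔼 2)) := by
  intro x hx h
  apply hx
  exact Subtype.ext (tubeParam_injOn p (ball_subset_ball hr1 x.2) (mem_ball_self one_pos) h)

/-- **The model class at `p`**: the reference generator `μ_E(p)` pushed to
`H₃(S¹ × ℝ² | (e^{ip₀}, p_tail); ℤ)` by `tubeParam`. [folklore] -/
def modelClass (p : 𝔼 3) (r : ℝ) (hr : 0 < r) (hr1 : r ≤ 1) :
    localHomology ℤ ℤ ((𝕊 1) × 𝔼 2) (tubeParam p) 3 :=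
  relativeSingularHomology.map ℤ ℤ (tubeParamBall p r) (mapsTo_tubeParamBall p hr hr1) 3
    ((localHomology.openSubsetIso ℤ ℤ isOpen_ball (mem_ball_self hr) 3).inv ((μE 3).localClass p))

namespace Knot.TubularNbhd

variable {K : Knot} (ν : Knot.TubularNbhd K)

/-- The class pushed by the tube germ is `ν_*` of the model class. [folklore] -/
theorem push_germ (p : 𝔼 3) (r : ℝ) (hr : 0 < r) (hr1 : r ≤ 1) :
    (ν.germ p r hr hr1).push = relativeSingularHomology.map ℤ ℤ ν.toCMap
      (ν.mapsTo_toCMap (tubeParam p)) 3 (modelClass p r hr hr1) := by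
  rw [PosGerm.push, modelClass, ← ModuleCat.comp_apply, ← relativeSingularHomology.map_comp]
  rfl

/-- **Small tube germs landing in a hemisphere push the reference generator to `σ_H · μ`.**
[folklore] -/
theorem exists_radius_push_eq (p : 𝔼 3) (H : Hemisphere) (μ : HomologicalOrientation ℤ (𝕊 3) 3)
    (hp : ν (tubeParam p) ∈ H.dom) {s : ℤ} (hs : s * s = 1)
    (hsign : ∀ y : ↥(ball (0 : 𝔼 3) 1),
      (H.transported μ).localClass y = s • ballOrientation.localClass y) :
    ∃ r₀ : ℝ, 0 < r₀ ∧ r₀ ≤ 1 ∧ ∀ (r : ℝ) (hr : 0 < r) (hr1 : r ≤ 1), r ≤ r₀ →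
      (ν.germ p r hr hr1).push = s • μ.localClass (ν (tubeParam p)) := by
  -- `⟪u, F_ν x⟫ > 0` near `p`
  have hc : ContinuousAt (fun x ↦ ⟪H.u, ν.liftE x⟫) p :=
    (continuous_const.inner ν.contDiff_liftE.continuous).continuousAt
  have hpos : ∀ᶠ x in 𝓝 p, 0 < ⟪H.u, ν.liftE x⟫ := hc.eventually (isOpen_Ioi.mem_nhds hp)
  obtain ⟨r₁, hr₁, hball⟩ := Metric.eventually_nhds_iff_ball.1 hpos
  refine ⟨min r₁ 1, lt_min hr₁ one_pos, min_le_right _ _, fun r hr hr1 hrr ↦ ?_⟩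
  have hdom : ∀ x ∈ ball (ν.germ p r hr hr1).p (ν.germ p r hr hr1).r, 0 < ⟪H.u, (ν.germ p r hr hr1).F x⟫ :=
    fun x hx ↦ hball x (ball_subset_ball (hrr.trans (min_le_left _ _)) hx)
  exact (ν.germ p r hr hr1).push_eq H μ hdom hs hsign

/-- The conclusion of the main theorem from a common sign at `p`. [folklore] -/
theorem map_localClass_eq_of_common_sign {K₁ K₂ : Knot} (ν₁ : Knot.TubularNbhd K₁)
    (ν₂ : Knot.TubularNbhd K₂) (μ : HomologicalOrientation ℤ (𝕊 3) 3) (p : 𝔼 3)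
    {r : ℝ} (hr : 0 < r) (hr1 : r ≤ 1) {s : ℤ} (hs : s * s = 1)
    (h1 : (ν₁.germ p r hr hr1).push = s • μ.localClass (ν₁ (tubeParam p)))
    (h2 : (ν₂.germ p r hr hr1).push = s • μ.localClass (ν₂ (tubeParam p)))
    (c : localHomology ℤ ℤ ((𝕊 1) × 𝔼 2) (tubeParam p) 3)
    (hc : relativeSingularHomology.map ℤ ℤ ν₁.toCMap (ν₁.mapsTo_toCMap (tubeParam p)) 3 c =
      μ.localClass (ν₁ (tubeParam p))) :
    relativeSingularHomology.map ℤ ℤ ν₂.toCMap (ν₂.mapsTo_toCMap (tubeParam p)) 3 c =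
      μ.localClass (ν₂ (tubeParam p)) := by
  rw [push_germ] at h1 h2
  have hinj : Function.Injective
      (relativeSingularHomology.map ℤ ℤ ν₁.toCMap (ν₁.mapsTo_toCMap (tubeParam p)) 3) := by
    have hiso := localHomology.isIso_map_of_isOpenEmbedding_of_eq ℤ ℤ ν₁.toCMap ν₁.isOpenEmbedding
      (tubeParam p) rfl 3
    exact (ModuleCat.mono_iff_injective _).1 hiso.mono_of_iso
  have hcs : c = s • modelClass p r hr hr1 := by
    apply hinj
    rw [map_zsmul, h1, smul_smul, hs, one_smul, hc]
  rw [hcs, map_zsmul, h2, smul_smul, hs, one_smul]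

/-- **All oriented tubular neighbourhoods of all knots transport the same local orientation.**
Let `μ` be a `ℤ`-orientation of `S³`, `ν₁`, `ν₂` oriented tubular neighbourhoods of knots `K₁`,
`K₂`, `m ∈ S¹ × ℝ²` and `c ∈ H₃(S¹ × ℝ² | m; ℤ)`. If `(ν₁)_* c = μ_{ν₁ m}` then `(ν₂)_* c = μ_{ν₂ m}`.
This is the homological content of the orientation convention `det_pos` of `Knot.TubularNbhd`
(Bredon 1993, VI.7, proof of Thm. 7.15: orientation-preserving diffeomorphisms have local degree `+1`):
lift `m` to `p ∈ ℝ³`; both tube germs at `p` are positively oriented; if `ν₁ m`, `ν₂ m` are not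
antipodal they lie in one hemisphere chart and both push `μ_E(p)` to `σ · μ` with the same sign
(`exists_radius_push_eq`), whence the claim (`map_localClass_eq_of_common_sign`); if they are
antipodal, a nearby point `ν₁ m'` is compared with both through two hemispheres.
[cite: Bredon1993, VI.7 Thm. 7.15 (proof)] -/
theorem map_localClass_eq_of_map_localClass_eq {K₁ K₂ : Knot} (ν₁ : Knot.TubularNbhd K₁)
    (ν₂ : Knot.TubularNbhd K₂) (μ : HomologicalOrientation ℤ (𝕊 3) 3) (m : (𝕊 1) × 𝔼 2)
    (c : localHomology ℤ ℤ ((𝕊 1) × 𝔼 2) m 3)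
    (hc : relativeSingularHomology.map ℤ ℤ ν₁.toCMap (ν₁.mapsTo_toCMap m) 3 c = μ.localClass (ν₁ m)) :
    relativeSingularHomology.map ℤ ℤ ν₂.toCMap (ν₂.mapsTo_toCMap m) 3 c = μ.localClass (ν₂ m) := by
  obtain ⟨p, rfl⟩ := tubeParam_surjective m
  set q₁ : 𝕊 3 := ν₁ (tubeParam p) with hq₁
  set q₂ : 𝕊 3 := ν₂ (tubeParam p) with hq₂
  by_cases hanti : (q₁ : 𝔼 4) + q₂ ≠ 0
  · -- one hemisphere containing both
    obtain ⟨H, hH₁, hH₂⟩ := Hemisphere.exists_mem_dom_and_mem_dom q₁ q₂ hanti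
    obtain ⟨s, hs, hsign⟩ := H.exists_sign μ
    obtain ⟨ra, hra, hra1, ha⟩ := ν₁.exists_radius_push_eq p H μ hH₁ hs hsign
    obtain ⟨rb, hrb, hrb1, hb⟩ := ν₂.exists_radius_push_eq p H μ hH₂ hs hsign
    have hr : 0 < min ra rb := lt_min hra hrb
    have hr1 : min ra rb ≤ 1 := (min_le_left _ _).trans hra1
    exact map_localClass_eq_of_common_sign ν₁ ν₂ μ p hr hr1 hs
      (ha _ hr hr1 (min_le_left _ _)) (hb _ hr hr1 (min_le_right _ _)) c hc
  · -- antipodal: compare through a nearby point of the first tube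
    rw [not_not] at hanti
    -- a point `p'` near `p` with `ν₁ m'` neither `q₁` nor `-q₁ = q₂`
    have hcont : ContinuousAt ν₁.liftE p := ν₁.contDiff_liftE.continuous.continuousAt
    have hnear : ∀ᶠ x in 𝓝 p, dist (ν₁.liftE x) (ν₁.liftE p) < 2 :=
      hcont.eventually (ball_mem_nhds _ two_pos)
    obtain ⟨δ, hδ, hδball⟩ := Metric.eventually_nhds_iff_ball.1 hnear
    set δ' : ℝ := min δ 1 / 2 with hδ'
    have hδ'pos : 0 < δ' := by positivity
    have hδ'lt : δ' < min δ 1 := by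
      rw [hδ']
      linarith [lt_min hδ one_pos]
    set p' : 𝔼 3 := p + δ' • e₃ 0 with hp'
    have hp'p : dist p' p = δ' := by
      rw [hp', dist_eq_norm, add_sub_cancel_left, norm_smul, Real.norm_eq_abs, abs_of_pos hδ'pos]
      simp [e₃, EuclideanSpace.basisFun_apply]
    have hp'ball : p' ∈ ball p (min δ 1) := by rw [mem_ball, hp'p]; exact hδ'lt
    have hp'ne : p' ≠ p := by
      intro h
      rw [h, dist_self] at hp'p
      exact hδ'pos.ne' hp'p.symm
    set q₃ : 𝕊 3 := ν₁ (tubeParam p') with hq₃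
    have hq₃₁ : (q₁ : 𝔼 4) + q₃ ≠ 0 := by
      intro h
      have h3 : (q₃ : 𝔼 4) = -q₁ := eq_neg_of_add_eq_zero_right h
      have hd := hδball p' (ball_subset_ball (min_le_left _ _) hp'ball)
      rw [liftE_apply, liftE_apply] at hd
      change dist (q₃ : 𝔼 4) (q₁ : 𝔼 4) < 2 at hd
      rw [h3, dist_eq_norm, show -(q₁ : 𝔼 4) - q₁ = -((2 : ℝ) • (q₁ : 𝔼 4)) by rw [two_smul]; abel,
        norm_neg, norm_smul, norm_eq_of_mem_sphere q₁, Real.norm_eq_abs] at hd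
      norm_num at hd
    have hq₃₂ : (q₃ : 𝔼 4) + q₂ ≠ 0 := by
      intro h
      have h3 : (q₃ : 𝔼 4) = q₁ := by
        have e2 : (q₂ : 𝔼 4) = -q₁ := eq_neg_of_add_eq_zero_right hanti
        have h4 : (q₃ : 𝔼 4) - q₁ = 0 := by rw [sub_eq_add_neg, ← e2]; exact h
        exact sub_eq_zero.1 h4
      have hinj := ν₁.liftE_injOn p (ball_subset_ball (min_le_right _ _) hp'ball)
        (mem_ball_self one_pos)
      exact hp'ne (hinj (by rw [liftE_apply, liftE_apply]; exact h3))
    obtain ⟨Ha, hHa₁, hHa₃⟩ := Hemisphere.exists_mem_dom_and_mem_dom q₁ q₃ hq₃₁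
    obtain ⟨Hb, hHb₃, hHb₂⟩ := Hemisphere.exists_mem_dom_and_mem_dom q₃ q₂ hq₃₂
    obtain ⟨sa, hsa, hsigna⟩ := Ha.exists_sign μ
    obtain ⟨sb, hsb, hsignb⟩ := Hb.exists_sign μ
    -- the two signs agree, by comparison at `p'`
    obtain ⟨ra, hra, hra1, ha⟩ := ν₁.exists_radius_push_eq p' Ha μ hHa₃ hsa hsigna
    obtain ⟨rb, hrb, hrb1, hb⟩ := ν₁.exists_radius_push_eq p' Hb μ hHb₃ hsb hsignb
    have hab : sa = sb := by
      have hr : 0 < min ra rb := lt_min hra hrb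
      have hr1 : min ra rb ≤ 1 := (min_le_left _ _).trans hra1
      have h := (ha _ hr hr1 (min_le_left _ _)).symm.trans (hb _ hr hr1 (min_le_right _ _))
      obtain ⟨e, he⟩ := μ.isGenerator q₃
      have h' := congrArg e h
      rw [map_zsmul, map_zsmul, he, smul_eq_mul, smul_eq_mul, mul_one, mul_one] at h'
      exact h'
    -- now both tubes at `p` with the sign `sa`
    obtain ⟨rc, hrc, hrc1, hc1⟩ := ν₁.exists_radius_push_eq p Ha μ hHa₁ hsa hsigna
    obtain ⟨rd, hrd, hrd1, hd2⟩ := ν₂.exists_radius_push_eq p Hb μ hHb₂ hsb hsignb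
    have hr : 0 < min rc rd := lt_min hrc hrd
    have hr1 : min rc rd ≤ 1 := (min_le_left _ _).trans hrc1
    refine map_localClass_eq_of_common_sign ν₁ ν₂ μ p hr hr1 hsa
      (hc1 _ hr hr1 (min_le_left _ _)) ?_ c hc
    rw [hab]
    exact hd2 _ hr hr1 (min_le_right _ _)

end Knot.TubularNbhd

end Literature.Topology.FourManifolds
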